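/-
Copyright (c) 2026 the pub-hodgecm-mathlib formalisation cell (harness21).  Prover seat hodgecm-mathlib-K2E4-p14 (g13), R90-TF SLAB section S4
«Ch13.1–2» (base R90-C131, across-lines valve hand), h413 = `stmt-HodgeConjecture-24833`; brick (DICT)(2) CARD A′ = the (T2″) sub-brick (S4 dealer K2E2-plan (g8),
R90 bus 2026-09-05T02:25:40Z S4-R39 (4)).
-/
import Summits.HodgeConjecture.HodgeConjecture.Theorems.R90S4TypeTwoBlockFrameOfCharpoly   -- ★ p864552 FILE 0 (this seat): `exists_blockFrame_gqs_of_charpoly`, `squarefree_mul_X_sub_C_of_irreducible`, `minpoly_eq_charpoly_of_squarefree`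
import Summits.HodgeConjecture.HodgeConjecture.Theorems.R90S4TypeOneFinerCount             -- ★ F5b (R90-C131-p01): the type-(1) twin `natCard_stableSet_eq_six`; `Gqs` plumbing (★ F3a `unitaryGroupOfForm_cmLocalForm_eq_unitaryGroup`, …)
import HarnessLib

/-!
# R90-TF · S4 — (DICT)(2) CARD A′ `R90S4TypeTwoStableSetCount`: for a TYPE-(2) torus `k = Z(s₁)` of `U(Φ₃)(L⁺_v)` (`v` non-split; `χ_{s₁} = q · (X − u)`, `q` irreducible
# quadratic) and any `t` with the same characteristic polynomial, `|{s ∈ k : s ∼_{st} t}| = 2` (Rogawski 1990, §3.6 type (2) `T = T_K × E¹`, §12.5 p. 182: `|Ω_F(T)| = 2`)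

Cell `hodgecm-mathlib`, crux H413 = `stmt-HodgeConjecture-24833`, route of record `HCCMUnconditional`; R90-TF section S4 (Rogawski Ch. 13.1–2, base `R90-C131`),
S4 dealer K2E2-plan (g8), hand K2E4-p14 (g13).  The type-(2) twin of ★ F5b `R90S4TypeOneFinerCount` §1 (`isStablyConjGAt_of_charpoly_eq_prod`, `natCard_stableSet_eq_six`),
stated in the (β) CHARACTERISTIC-POLYNOMIAL letter («`χ = q · (X − C u)`, `q` irreducible of degree `2`») so that the (DICT)(2) assembler feeds CARD D §2's type-(2) disjunct with
zero casts.  THEOREMS ONLY (no `def`, no `instance`, no notation, no named-fact hypothesis, no `sorry`; default heartbeats); ★-only imports; lane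
`--supports stmt-HodgeConjecture-24833 --as helper`.

THE MATHEMATICS.  `G_v = Gqs L v = U(Φ₃)(L⁺_v)`, `v` NON-SPLIT (`L ⊗ L⁺_v = L_w` a field of characteristic `0`), `σ = c ⊗ 1`, `H = Φ₃` (★ `cmLocalForm L 3 v`), `⋆` the `H`-adjoint
`y⋆ = H⁻¹ ᵗ(σy) H` (★ `hermStar`).  Let `s₁ ∈ G_v` have `χ_{s₁} = q · (X − u)` with `q ∈ L_w[X]` irreducible quadratic: by ★ FILE 0 there is a block frame `s₁ = P [A 0; 0 u] P⁻¹`,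
`χ_A = q`; `k = Z_{G_v}(s₁)` is the type-(2) torus `T ≅ T_K × E¹` of [§3.6].
* §1 (matrix level, any field of characteristic `0`).  (Q) A `2 × 2` matrix `Y` COMMUTING with `A` and with `χ_Y = χ_A` is `A` or `A′ := (tr A)·1 − A` (the Galois conjugate
  root of `q` in the field `L_w[A]`): `Y = α + βA` (★ `exists_eq_smul_one_add_smul_of_commute`), and comparing trace and determinant gives `(1 − β)(1 + β)(t² − 4 det A) = 0` with
  `t² − 4 det A ≠ 0` (`q` has no root).  (C) A `3 × 3` matrix `x` COMMUTING with `γ = P [A 0; 0 u] P⁻¹` and with `χ_x = χ_γ` is `γ` or `γ′ := P [A′ 0; 0 u] P⁻¹`: the commutant is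
  `P [B 0; 0 d] P⁻¹`, `B ∈ L_w[A]` (★ `commute_iff_exists_frame_fromBlocks_of_irreducible`), and `χ_B · (X − d) = χ_A · (X − u)` forces `d = u`, `χ_B = χ_A`.  (U) THE HONEST STEP —
  `γ′` IS UNITARY when `γ` is: `γ′` commutes with `γ` and has the same SQUAREFREE characteristic polynomial, so `γ′ = S⁻¹ γ S` (★ FILE 0's non-derogatory road), whence
  `γ′⋆ = S⋆ γ⁻¹ (S⋆)⁻¹` (`⋆` anti-multiplicative, `γ⋆ = γ⁻¹`); the matrix `x̃ := S⋆ γ (S⋆)⁻¹`, inverse to `γ′⋆`, COMMUTES with `γ` (apply `⋆` to `γ′γ = γγ′`) and has `χ_{x̃} = χ_γ`, so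
  by (C) `x̃ ∈ {γ, γ′}`: if `x̃ = γ′` then `γ′⋆ γ′ = 1`; if `x̃ = γ` then `γ′⋆ = γ⋆`, i.e. `γ′ = γ`.  Either way `γ′ ∈ U(H)`.  (This is print's remark that the adjoint involution `τ`
  of `L_w[A]` commutes with `Gal(L_w[A]∕L_w)`, read matrix-side without constructing the field `L_w[A]`.)
* §2 (`Gqs` level).  `isStablyConjGAt_of_charpoly_eq_mul`: two elements of `G_v` with the same `χ = q · (X − u)` are stably conjugate (both non-derogatory with the same `χ`, ★
  `exists_conj_eq_of_minpoly_eq_charpoly`).  `natCard_stableSet_eq_two`: the elements of `k = Z(s₁)` stably conjugate to `t` (`χ_t = χ_{s₁}`) are EXACTLY `s₁` and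
  `s₁′ = P [A′ 0; 0 u] P⁻¹` — `s₁′ ∈ G_v` by (U), `s₁′ ∈ k` (it commutes), `s₁′ ≠ s₁` (`A′ = A` would make `A` scalar, `χ_A` reducible), and every such `s` commutes with `s₁` with
  `χ_s = χ_t = χ_{s₁}`, so `s ∈ {s₁, s₁′}` by (C).  HONEST NOTE: characteristic `0` (or separability of `q`) is load-bearing — over an imperfect field of characteristic `2` with `q`
  inseparable the set has ONE element; `L_w` has characteristic `0` (`charZero_of_injective_algebraMap`).

HONEST LABEL: HC_CM is proved only modulo the 7 printed citations (2 remaining named inputs: hLiu418 = `stmt-HodgeConjecture-24832`, h413 = `stmt-HodgeConjecture-24833`) until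
rung 0 closes; (T2″) is an input of the type-(2) rows of the finer Weyl count behind ★ (B2-S) behind the OPEN (W-NP) socket — a ★ helper closes no socket; REL ≠ ★ ≠ BUILT;
count-neutral.

## References
* [Rogawski1990] J. D. Rogawski, *Automorphic Representations of Unitary Groups in Three Variables*, Ann. of Math. Stud. 123 (1990), §3.6 pp. 28–31 (type (2): `T = T_K × E¹`),
  §3.5 Prop. 3.5.2 (a)(c) p. 29, §3.1 p. 19, §12.5 p. 182 («the number of `ν ∈ 𝔇(T∕F)` such that `T^ν` is conjugate to `T″` is `|Ω_F(T)|∕|Ω(T″)|`»).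
* [HornJohnson2013] R. A. Horn, C. R. Johnson, *Matrix Analysis*, 2nd ed. (CUP 2013), §3.2.4 Thm. 3.2.4.2 p. 185 (commutant of a non-derogatory matrix), Thm 3.3.15 p. 257,
  3.3.P12 p. 258.
-/

set_option autoImplicit false
-- the mandated namespace repeats the single-problem summit's segment (`HodgeConjecture.HodgeConjecture`)
set_option linter.dupNamespace false

noncomputable section

open Matrix Polynomial
open NumberField IsDedekindDomain
open Literature.NumberTheory.Automorphic Literature.NumberTheory.Automorphic.UnitaryGroup Literature.NumberTheory.Rogawski1990
open Literature.AlgebraicGeometry.ShimuraVarieties (unitaryGroup mem_unitaryGroup_iff)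
open Literature.LinearAlgebra.Matrix (eval_charpoly_ne_zero_of_irreducible exists_eq_smul_one_add_smul_of_commute commute_iff_exists_frame_fromBlocks_of_irreducible)
open scoped MatrixGroups

namespace Summit.HodgeConjecture.HodgeConjecture.R90.S4

/-! ## §1 Matrix level over a field of characteristic `0` -/

section Field

variable {K : Type*} [Field K]

/-- The `2 × 2` calculus of `α•1 + β•A`: trace and determinant. [folklore] -/
theorem trace_smul_one_add_smul_two (A : Matrix (Fin 2) (Fin 2) K) (α β : K) :
    (α • (1 : Matrix (Fin 2) (Fin 2) K) + β • A).trace = 2 * α + β * A.trace ∧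
      (α • (1 : Matrix (Fin 2) (Fin 2) K) + β • A).det = α ^ 2 + α * β * A.trace + β ^ 2 * A.det := by
  constructor
  · simp only [Matrix.trace_fin_two, Matrix.add_apply, Matrix.smul_apply, Matrix.one_apply_eq, smul_eq_mul]
    ring
  · simp only [Matrix.det_fin_two, Matrix.trace_fin_two, Matrix.add_apply, Matrix.smul_apply, Matrix.one_apply_eq,
      Matrix.one_apply_ne (by decide : (0 : Fin 2) ≠ 1), Matrix.one_apply_ne (by decide : (1 : Fin 2) ≠ 0), smul_eq_mul]
    ring

/-- The characteristic polynomial of `(tr A)•1 − A` is that of `A` (`2 × 2`; the two roots of `χ_A` are exchanged). [cite: HornJohnson2013, §1.2 (trace and determinant of a `2 × 2` matrix)] -/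
theorem charpoly_trace_smul_one_sub (A : Matrix (Fin 2) (Fin 2) K) : (A.trace • (1 : Matrix (Fin 2) (Fin 2) K) - A).charpoly = A.charpoly := by
  nontriviality K
  have htr : (A.trace • (1 : Matrix (Fin 2) (Fin 2) K) - A).trace = A.trace := by
    simp only [Matrix.trace_fin_two, Matrix.sub_apply, Matrix.smul_apply, Matrix.one_apply_eq, smul_eq_mul]
    ring
  have hdet : (A.trace • (1 : Matrix (Fin 2) (Fin 2) K) - A).det = A.det := by
    simp only [Matrix.det_fin_two, Matrix.trace_fin_two, Matrix.sub_apply, Matrix.smul_apply, Matrix.one_apply_eq,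
      Matrix.one_apply_ne (by decide : (0 : Fin 2) ≠ 1), Matrix.one_apply_ne (by decide : (1 : Fin 2) ≠ 0), smul_eq_mul]
    ring
  rw [charpoly_fin_two, charpoly_fin_two, htr, hdet]

/-- **(Q) The two roots of `χ_A` in `K[A]`.**  Over a field of characteristic `0`: a `2 × 2` matrix `Y` commuting with `A` (`χ_A` irreducible) and with `χ_Y = χ_A` is `A` or
`A′ = (tr A)•1 − A` — `Y = α•1 + β•A` (★ commutant of a non-derogatory `2 × 2` matrix) and the trace∕determinant comparison reads `(1 − β)(1 + β)(tr² A − 4 det A) = 0` with a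
non-zero discriminant (`χ_A(tr A ∕ 2) ≠ 0`). [cite: HornJohnson2013, §3.2.4 Thm. 3.2.4.2 p. 185] [cite: Rogawski1990, §3.6 p. 31] -/
theorem eq_or_eq_trace_smul_sub_of_commute_of_charpoly_eq [CharZero K] {A Y : Matrix (Fin 2) (Fin 2) K} (hA : Irreducible A.charpoly) (hY : Commute Y A)
    (h : Y.charpoly = A.charpoly) : Y = A ∨ Y = A.trace • (1 : Matrix (Fin 2) (Fin 2) K) - A := by
  obtain ⟨α, β, rfl⟩ := exists_eq_smul_one_add_smul_of_commute hA hY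
  obtain ⟨htr, hdet⟩ := trace_smul_one_add_smul_two A α β
  obtain ⟨t, ht⟩ : ∃ t : K, A.trace = t := ⟨_, rfl⟩
  obtain ⟨n, hn⟩ : ∃ n : K, A.det = n := ⟨_, rfl⟩
  -- trace and determinant agree
  have h1 : 2 * α + β * t = t := by
    rw [← ht, ← htr, Matrix.trace_eq_neg_charpoly_coeff, Matrix.trace_eq_neg_charpoly_coeff A, h]
  have h2 : α ^ 2 + α * β * t + β ^ 2 * n = n := by
    rw [← ht, ← hn, ← hdet, Matrix.det_eq_sign_charpoly_coeff, Matrix.det_eq_sign_charpoly_coeff A, h]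
  -- the discriminant is non-zero: `χ_A (t/2) = n - t²/4 ≠ 0`
  have hdisc : t ^ 2 - 4 * n ≠ 0 := by
    intro h0
    have hev := eval_charpoly_ne_zero_of_irreducible hA (by simp) (t / 2)
    rw [Matrix.charpoly_fin_two, ht, hn] at hev
    apply hev
    simp only [eval_add, eval_sub, eval_mul, eval_pow, eval_C, eval_X]
    linear_combination (-(1 : K) / 4) * h0
  have key : (1 - β) * (1 + β) * (t ^ 2 - 4 * n) = 0 := by
    linear_combination (4 : K) * h2 - (2 * α + t + β * t) * h1
  rcases mul_eq_zero.1 key with h12 | h3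
  · rcases mul_eq_zero.1 h12 with hb | hb
    · -- `β = 1`, `α = 0`
      have hβ : β = 1 := by linear_combination -hb
      have hα : α = 0 := by
        have h4 : (2 : K) * α = 0 := by rw [hβ] at h1; linear_combination h1
        exact (mul_eq_zero.1 h4).resolve_left two_ne_zero
      left
      rw [hα, hβ, zero_smul, one_smul, zero_add]
    · -- `β = -1`, `α = t`
      have hβ : β = -1 := by linear_combination hb
      have hα : α = t := by
        have h4 : (2 : K) * (α - t) = 0 := by rw [hβ] at h1; linear_combination h1
        exact sub_eq_zero.1 ((mul_eq_zero.1 h4).resolve_left two_ne_zero)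
      right
      rw [hα, hβ, neg_one_smul, ← sub_eq_add_neg, ht]
  · exact absurd h3 hdisc

/-- The characteristic polynomial of a conjugated block matrix `P [B 0; 0 d] P⁻¹` is `χ_B · (X − d)`. [cite: HornJohnson2013, §0.9.2 (block diagonal matrices)] -/
theorem charpoly_conj_blockFrame {n : Type*} [Fintype n] [DecidableEq n] (P : GL n K) (e : Fin 2 ⊕ Fin 1 ≃ n) (B : Matrix (Fin 2) (Fin 2) K) (d : K) :
    (P.val * reindex e e (fromBlocks B 0 0 !![d]) * (P⁻¹).val).charpoly = B.charpoly * (X - C d) := by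
  rw [Matrix.coe_units_inv, Matrix.charpoly_units_conj, charpoly_reindex, charpoly_fromBlocks_zero₁₂, charpoly_fin_one_of]

/-- `γ = P [A 0; 0 u] P⁻¹` from the frame letter `γ P = P [A 0; 0 u]`. [folklore] -/
theorem eq_conj_blockFrame_of_frame {n : Type*} [Fintype n] [DecidableEq n] {γ : Matrix n n K} {P : GL n K} {e : Fin 2 ⊕ Fin 1 ≃ n}
    {A : Matrix (Fin 2) (Fin 2) K} {u : K} (hP : γ * P.val = P.val * reindex e e (fromBlocks A 0 0 !![u])) :
    γ = P.val * reindex e e (fromBlocks A 0 0 !![u]) * (P⁻¹).val := by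
  rw [← hP, Matrix.mul_assoc, ← Units.val_mul, mul_inv_cancel, Units.val_one, Matrix.mul_one]

/-- **(C) THE CLASSIFICATION IN THE COMMUTANT.**  Over a field of characteristic `0`: for `γ P = P [A 0; 0 u]` with `χ_A` irreducible (`2 × 2`), a matrix `x` COMMUTING with `γ`
and with `χ_x = χ_γ` is `γ` or `γ′ = P [A′ 0; 0 u] P⁻¹`, `A′ = (tr A)•1 − A` — the commutant is `P [B 0; 0 d] P⁻¹` with `B ∈ K[A]` (★ `commute_iff_exists_frame_fromBlocks_of_irreducible`),
`χ_B (X − d) = χ_A (X − u)` forces `d = u` (`χ_A` has no root) and `χ_B = χ_A`, then (Q). [cite: HornJohnson2013, §3.2.4 Thm. 3.2.4.2 p. 185] [cite: Rogawski1990, §3.6 p. 31] -/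
theorem eq_or_eq_conj_blockFrame_of_commute_of_charpoly_eq [CharZero K] {n : Type*} [Fintype n] [DecidableEq n] {γ : Matrix n n K} {P : GL n K}
    {e : Fin 2 ⊕ Fin 1 ≃ n} {A : Matrix (Fin 2) (Fin 2) K} {u : K} (hP : γ * P.val = P.val * reindex e e (fromBlocks A 0 0 !![u])) (hA : Irreducible A.charpoly)
    {x : Matrix n n K} (hx : Commute x γ) (h : x.charpoly = γ.charpoly) :
    x = γ ∨ x = P.val * reindex e e (fromBlocks (A.trace • (1 : Matrix (Fin 2) (Fin 2) K) - A) 0 0 !![u]) * (P⁻¹).val := by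
  obtain ⟨B, d, hB, rfl⟩ := (commute_iff_exists_frame_fromBlocks_of_irreducible hP hA).1 hx
  have hγ := eq_conj_blockFrame_of_frame hP
  rw [hγ, charpoly_conj_blockFrame, charpoly_conj_blockFrame] at h
  -- `d = u`: `X - C d` divides `χ_A (X - C u)` and not `χ_A`
  have hdu : d = u := by
    have hdvd : X - C d ∣ A.charpoly * (X - C u) := h ▸ dvd_mul_left _ _
    rcases (prime_X_sub_C d).dvd_or_dvd hdvd with h1 | h1
    · exact absurd (dvd_iff_isRoot.1 h1) (eval_charpoly_ne_zero_of_irreducible hA (by simp) d)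
    · have h2 := dvd_iff_isRoot.1 h1
      rw [IsRoot.def, eval_sub, eval_X, eval_C, sub_eq_zero] at h2
      exact h2
  subst hdu
  have hBA : B.charpoly = A.charpoly := mul_right_cancel₀ (X_sub_C_ne_zero d) h
  rcases eq_or_eq_trace_smul_sub_of_commute_of_charpoly_eq hA hB hBA with h1 | h1
  · left; rw [hγ, h1]
  · right; rw [h1]

/-- `⋆` commutes with inversion: `(S⁻¹)⋆ = (S⋆)⁻¹` for `S`, `H` invertible. [cite: Rogawski1990, §3.5 p. 29] -/
theorem hermStar_inv_eq {n : Type*} [Fintype n] [DecidableEq n] (σ : K →+* K) {H : Matrix n n K} (hH : IsUnit H.det) {S : Matrix n n K} (hS : IsUnit S.det) :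
    hermStar σ H S⁻¹ = (hermStar σ H S)⁻¹ := by
  have h1 : hermStar σ H S * hermStar σ H S⁻¹ = 1 := by
    rw [← hermStar_mul σ H hH, Matrix.nonsing_inv_mul S hS, hermStar_one σ H hH]
  exact (Matrix.inv_eq_right_inv h1).symm

/-- `S⋆` is invertible when `S` is (`S⋆ (S⁻¹)⋆ = 1`). [cite: Rogawski1990, §3.5 p. 29] -/
theorem isUnit_det_hermStar {n : Type*} [Fintype n] [DecidableEq n] (σ : K →+* K) {H : Matrix n n K} (hH : IsUnit H.det) {S : Matrix n n K} (hS : IsUnit S.det) :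
    IsUnit (hermStar σ H S).det := by
  have h1 : hermStar σ H S * hermStar σ H S⁻¹ = 1 := by
    rw [← hermStar_mul σ H hH, Matrix.nonsing_inv_mul S hS, hermStar_one σ H hH]
  exact Matrix.isUnit_det_of_right_inverse h1

/-- From `x⋆ x = 1` to membership in `U(H)` (`H` invertible): `ᵗ(σx) H x = H`. [cite: Rogawski1990, §3.1 p. 19] -/
theorem mkOfDetNeZero_mem_unitaryGroup_of_hermStar_mul_self {n : Type*} [Fintype n] [DecidableEq n] (σ : K →+* K) {H : Matrix n n K} (hH : IsUnit H.det)
    {x : Matrix n n K} (h0 : x.det ≠ 0) (hxx : hermStar σ H x * x = 1) :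
    Matrix.GeneralLinearGroup.mkOfDetNeZero x h0 ∈ unitaryGroup σ H := by
  rw [← Literature.NumberTheory.Rogawski1990.twistGram_coe_eq_iff_mem_unitaryGroup]
  show twistGram σ H x = H
  rw [hermStar_def, Matrix.mul_assoc, Matrix.mul_assoc] at hxx
  have h : H * (H⁻¹ * ((x.map σ)ᵀ * (H * x))) = H * 1 := by rw [hxx]
  rw [Matrix.mul_nonsing_inv_cancel_left H _ hH, Matrix.mul_one, ← Matrix.mul_assoc] at h
  rw [twistGram_def]
  exact h

/-- **(U₀) EVERY ELEMENT OF THE COMMUTANT WITH THE SAME CHARACTERISTIC POLYNOMIAL IS UNITARY.**  Over a field of characteristic `0` with an involution `σ` and a `σ`-hermitian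
invertible `H`: if `γ ∈ U(H)` has a block frame `γ P = P [A 0; 0 u]` with `χ_A` irreducible (`2 × 2`) and `x` COMMUTES with `γ` with `χ_x = χ_γ`, then `x⋆ x = 1` — `x = S⁻¹ γ S`
(same squarefree `χ`, both non-derogatory; ★ FILE 0), `x⋆ = S⋆ γ⁻¹ (S⋆)⁻¹`, and `x̃ := S⋆ γ (S⋆)⁻¹` (inverse to `x⋆`) commutes with `γ` with `χ_{x̃} = χ_γ`, so `x, x̃ ∈ {γ, γ′}` by (C);
the four cases all give `x⋆ x = 1` (type (2) of [§3.6]: the adjoint involution of `L_w[A]` commutes with its Galois group, read matrix-side).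
[cite: Rogawski1990, §3.6 p. 31; §3.5 Prop. 3.5.2 (a) p. 29] [cite: HornJohnson2013, Thm 3.3.15 p. 257, 3.3.P12 p. 258] -/
theorem hermStar_mul_self_eq_one_of_commute_of_charpoly_eq [CharZero K] {σ : K →+* K} (hσ : ∀ r, σ (σ r) = r) {H : Matrix (Fin 3) (Fin 3) K}
    (hHh : (H.map σ)ᵀ = H) (hH : IsUnit H.det) {γ : GL (Fin 3) K} (hγ : γ ∈ unitaryGroup σ H) {P : GL (Fin 3) K} {e : Fin 2 ⊕ Fin 1 ≃ Fin 3}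
    {A : Matrix (Fin 2) (Fin 2) K} {u : K} (hP : γ.val * P.val = P.val * reindex e e (fromBlocks A 0 0 !![u])) (hA : Irreducible A.charpoly)
    {x : Matrix (Fin 3) (Fin 3) K} (hcomm : Commute x γ.val) (hchar : x.charpoly = γ.val.charpoly) : hermStar σ H x * x = 1 := by
  -- `x = S⁻¹ γ S`: both are non-derogatory with the same squarefree characteristic polynomial
  have hsq : Squarefree γ.val.charpoly := by
    rw [eq_conj_blockFrame_of_frame hP, charpoly_conj_blockFrame]
    exact squarefree_mul_X_sub_C_of_irreducible hA (by rw [charpoly_natDegree_eq_dim, Fintype.card_fin]) u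
  obtain ⟨S, hS, hxS⟩ := Literature.LinearAlgebra.Matrix.exists_conj_eq_of_minpoly_eq_charpoly γ.val x
    (minpoly_eq_charpoly_of_squarefree γ.val hsq) (minpoly_eq_charpoly_of_squarefree x (hchar.symm ▸ hsq)) hchar.symm
  -- the adjoint of `x` is `T γ⁻¹ T⁻¹`, `T = S⋆`
  obtain ⟨T, hTdef⟩ : ∃ T : Matrix (Fin 3) (Fin 3) K, hermStar σ H S = T := ⟨_, rfl⟩
  have hT : IsUnit T.det := hTdef ▸ isUnit_det_hermStar σ hH hS
  have hγstar : hermStar σ H γ.val = (γ⁻¹).val := hermStar_coe_eq_inv_of_mem_unitaryGroup σ H hH hγ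
  have hxstar : hermStar σ H x = T * (γ⁻¹).val * T⁻¹ := by
    rw [hxS, hermStar_mul σ H hH, hermStar_mul σ H hH, hermStar_inv_eq σ hH hS, hγstar, hTdef, ← Matrix.mul_assoc]
  have hγγ : (γ⁻¹).val * γ.val = 1 := by rw [← Units.val_mul, inv_mul_cancel, Units.val_one]
  have hγγ' : γ.val * (γ⁻¹).val = 1 := by rw [← Units.val_mul, mul_inv_cancel, Units.val_one]
  -- `x̃ := T γ T⁻¹` is inverse to `x⋆`, has `χ = χ_γ`, and commutes with `γ`
  obtain ⟨y, hydef⟩ : ∃ y : Matrix (Fin 3) (Fin 3) K, T * γ.val * T⁻¹ = y := ⟨_, rfl⟩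
  have hstar_y : hermStar σ H x * y = 1 := by
    rw [hxstar, ← hydef]
    calc T * (γ⁻¹).val * T⁻¹ * (T * γ.val * T⁻¹) = T * ((γ⁻¹).val * (T⁻¹ * T) * γ.val) * T⁻¹ := by simp only [Matrix.mul_assoc]
      _ = 1 := by rw [Matrix.nonsing_inv_mul T hT, Matrix.mul_one, hγγ, Matrix.mul_one, Matrix.mul_nonsing_inv T hT]
  have hy_star : y * hermStar σ H x = 1 := by
    rw [hxstar, ← hydef]
    calc T * γ.val * T⁻¹ * (T * (γ⁻¹).val * T⁻¹) = T * (γ.val * (T⁻¹ * T) * (γ⁻¹).val) * T⁻¹ := by simp only [Matrix.mul_assoc]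
      _ = 1 := by rw [Matrix.nonsing_inv_mul T hT, Matrix.mul_one, hγγ', Matrix.mul_one, Matrix.mul_nonsing_inv T hT]
  have hychar : y.charpoly = γ.val.charpoly := by
    rw [← hydef]
    exact Matrix.charpoly_units_conj (Matrix.GeneralLinearGroup.mkOfDetNeZero T hT.ne_zero) γ.val
  have hstar_comm : Commute (hermStar σ H x) γ.val := by
    -- `⋆` of `x γ = γ x` reads `γ⁻¹ x⋆ = x⋆ γ⁻¹`, i.e. `x⋆ γ = γ x⋆`
    have h1 : hermStar σ H (x * γ.val) = hermStar σ H (γ.val * x) := by rw [hcomm.eq]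
    rw [hermStar_mul σ H hH, hermStar_mul σ H hH, hγstar] at h1
    have h2 : γ.val * ((γ⁻¹).val * hermStar σ H x) * γ.val = γ.val * (hermStar σ H x * (γ⁻¹).val) * γ.val := by rw [h1]
    rw [← Matrix.mul_assoc, hγγ', Matrix.one_mul, Matrix.mul_assoc, Matrix.mul_assoc, hγγ, Matrix.mul_one] at h2
    exact h2
  have hycomm : Commute y γ.val := by
    have h1 : y * (hermStar σ H x * γ.val) * y = y * (γ.val * hermStar σ H x) * y := by rw [hstar_comm.eq]
    rw [← Matrix.mul_assoc, hy_star, Matrix.one_mul, Matrix.mul_assoc, Matrix.mul_assoc, hstar_y, Matrix.mul_one] at h1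
    exact h1.symm
  -- (C) for `x̃` and for `x`
  rcases eq_or_eq_conj_blockFrame_of_commute_of_charpoly_eq hP hA hycomm hychar with h1 | h1
  · -- `x̃ = γ`: `x⋆ = γ⁻¹ = γ⋆`, so `x = γ`
    have h2 : hermStar σ H x = hermStar σ H γ.val := by
      rw [hγstar]
      calc hermStar σ H x = hermStar σ H x * (γ.val * (γ⁻¹).val) := by rw [hγγ', Matrix.mul_one]
        _ = (γ⁻¹).val := by rw [← Matrix.mul_assoc, ← h1, hstar_y, Matrix.one_mul]
    have h3 : x = γ.val := by
      rw [← hermStar_hermStar σ H hH hσ hHh x, h2, hermStar_hermStar σ H hH hσ hHh]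
    rw [h3]
    exact hermStar_mul_self_of_mem_unitaryGroup σ H hH hγ
  · rcases eq_or_eq_conj_blockFrame_of_commute_of_charpoly_eq hP hA hcomm hchar with h2 | h2
    · rw [h2]
      exact hermStar_mul_self_of_mem_unitaryGroup σ H hH hγ
    · -- `x̃ = γ′ = x`
      rw [← h1] at h2
      calc hermStar σ H x * x = hermStar σ H x * y := by rw [h2]
        _ = 1 := hstar_y

/-- **(U) THE CONJUGATE-ROOT ELEMENT IS UNITARY.**  Over a field of characteristic `0` with an involution `σ` and a `σ`-hermitian invertible `H`: if `γ ∈ U(H)` has a block frame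
`γ P = P [A 0; 0 u]` with `χ_A` irreducible (`2 × 2`), then `γ′ := P [A′ 0; 0 u] P⁻¹`, `A′ = (tr A)•1 − A`, lies in `U(H)` (it commutes with `γ` and `χ_{γ′} = χ_γ`; (U₀)).
[cite: Rogawski1990, §3.6 p. 31; §3.5 Prop. 3.5.2 (a) p. 29] -/
theorem conj_blockFrame_trace_smul_sub_mem_unitaryGroup [CharZero K] {σ : K →+* K} (hσ : ∀ r, σ (σ r) = r) {H : Matrix (Fin 3) (Fin 3) K}
    (hHh : (H.map σ)ᵀ = H) (hH : IsUnit H.det) {γ : GL (Fin 3) K} (hγ : γ ∈ unitaryGroup σ H) {P : GL (Fin 3) K} {e : Fin 2 ⊕ Fin 1 ≃ Fin 3}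
    {A : Matrix (Fin 2) (Fin 2) K} {u : K} (hP : γ.val * P.val = P.val * reindex e e (fromBlocks A 0 0 !![u])) (hA : Irreducible A.charpoly) :
    ∃ h0 : (P.val * reindex e e (fromBlocks (A.trace • (1 : Matrix (Fin 2) (Fin 2) K) - A) 0 0 !![u]) * (P⁻¹).val).det ≠ 0,
      Matrix.GeneralLinearGroup.mkOfDetNeZero _ h0 ∈ unitaryGroup σ H := by
  have hγ' := eq_conj_blockFrame_of_frame hP
  have hdet' : (A.trace • (1 : Matrix (Fin 2) (Fin 2) K) - A).det = A.det := by
    rw [det_eq_sign_charpoly_coeff, det_eq_sign_charpoly_coeff, charpoly_trace_smul_one_sub]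
  have hx0 : (P.val * reindex e e (fromBlocks (A.trace • (1 : Matrix (Fin 2) (Fin 2) K) - A) 0 0 !![u]) * (P⁻¹).val).det ≠ 0 := by
    have h := (Matrix.isUnits_det_units γ).ne_zero
    rw [hγ', det_conj_blockFrame] at h
    rw [det_conj_blockFrame, hdet']
    exact h
  refine ⟨hx0, mkOfDetNeZero_mem_unitaryGroup_of_hermStar_mul_self σ hH hx0 ?_⟩
  refine hermStar_mul_self_eq_one_of_commute_of_charpoly_eq hσ hHh hH hγ hP hA ?_ ?_
  · exact commute_conj_blockFrame e hP (((Commute.one_left A).smul_left A.trace).sub_left (Commute.refl A)) u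
  · rw [hγ', charpoly_conj_blockFrame, charpoly_conj_blockFrame, charpoly_trace_smul_one_sub]

/-- `A′ = (tr A)•1 − A ≠ A` for `χ_A` irreducible over a field of characteristic `0` (else `A = (tr A ∕ 2)•1` is scalar and `χ_A` has the root `tr A ∕ 2`).
[cite: HornJohnson2013, §1.2 (trace and determinant of a `2 × 2` matrix)] -/
theorem trace_smul_one_sub_ne [CharZero K] {A : Matrix (Fin 2) (Fin 2) K} (hA : Irreducible A.charpoly) :
    A.trace • (1 : Matrix (Fin 2) (Fin 2) K) - A ≠ A := by
  intro h
  have h2 : (2 : K) • A = A.trace • (1 : Matrix (Fin 2) (Fin 2) K) := by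
    rw [two_smul]; exact (sub_eq_iff_eq_add.1 h).symm
  obtain ⟨c, hc⟩ : ∃ c : K, A = c • (1 : Matrix (Fin 2) (Fin 2) K) :=
    ⟨(2 : K)⁻¹ * A.trace, by rw [mul_smul, ← h2, smul_smul, inv_mul_cancel₀ two_ne_zero, one_smul]⟩
  have hev := eval_charpoly_ne_zero_of_irreducible hA (by simp) c
  apply hev
  rw [hc, charpoly_fin_two]
  simp only [eval_add, eval_sub, eval_mul, eval_pow, eval_C, eval_X, Matrix.trace_fin_two, Matrix.det_fin_two, Matrix.smul_apply,
    Matrix.one_apply_eq, Matrix.one_apply_ne (by decide : (0 : Fin 2) ≠ 1), Matrix.one_apply_ne (by decide : (1 : Fin 2) ≠ 0), smul_eq_mul]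
  ring

end Field

/-! ## §2 On `Gqs L v = U(Φ₃)(L⁺_v)` at a non-split place: the (β)-letter stable class and the two-element set -/

section GqsLevel

variable (L : Type) [Field L] [NumberField L] [IsCMField L] (v : HeightOneSpectrum (𝓞 ↥(maximalRealSubfield L)))

variable {L v}

/-- **Two elements of `G_v` whose characteristic polynomials are the same `q · (X − u)`, `q` IRREDUCIBLE QUADRATIC, are stably conjugate** (`v` non-split): both are non-derogatory
with the same squarefree characteristic polynomial, hence `GL₃(L_w)`-conjugate (★ FILE 0's road, Horn–Johnson 3.3.P12) — the type-(2) twin of ★ F5b `isStablyConjGAt_of_charpoly_eq_prod`.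
[cite: Rogawski1990, §3.1 p. 19; §3.6 p. 31] [cite: HornJohnson2013, 3.3.P12 p. 258] -/
theorem isStablyConjGAt_of_charpoly_eq_mul (hns : ∀ w : PlacesOver L v, IsCMField.complexConj L • w.1 = w.1) {t s : Gqs L v}
    (q : (LocalRing L v)[X]) (u : LocalRing L v) (hq : Irreducible q) (hq2 : q.natDegree = 2)
    (ht : t.val.val.charpoly = q * (X - C u)) (hs : s.val.val.charpoly = q * (X - C u)) :
    IsStablyConjGAt L (R90.S4.splitFormGL L) v t s := by
  obtain ⟨w⟩ := (inferInstance : Nonempty (PlacesOver L v))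
  letI : Field (LocalRing L v) := (LocalRing.isField_of_smul_eq (IsCMField.complexConj L) (IsCMField.complexConj_ne_one L) w (hns w)).toField
  have hsq : Squarefree (q * (X - C u)) := squarefree_mul_X_sub_C_of_irreducible hq hq2 u
  obtain ⟨S, hS, hSe⟩ := Literature.LinearAlgebra.Matrix.exists_conj_eq_of_minpoly_eq_charpoly t.val.val s.val.val
    (minpoly_eq_charpoly_of_squarefree t.val.val (by rw [ht]; exact hsq)) (minpoly_eq_charpoly_of_squarefree s.val.val (by rw [hs]; exact hsq))
    (ht.trans hs.symm)
  refine (isStablyConjGAt_iff_exists_conj_eq t s).2 ⟨(Matrix.GeneralLinearGroup.mkOfDetNeZero S hS.ne_zero)⁻¹, Units.ext ?_⟩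
  rw [inv_inv, Units.val_mul, Units.val_mul, Matrix.coe_units_inv]
  exact hSe.symm

/-- **`|{s ∈ k : s ∼_{st} t}| = 2`** for a TYPE-(2) torus `k = Z(s₁)` (`χ_{s₁} = q · (X − C u)`, `q` irreducible quadratic; `v` non-split) and any `t` with the same characteristic polynomial:
in the block frame `s₁ = P [A 0; 0 u] P⁻¹` of ★ FILE 0 the two elements are `s₁` and `s₁′ = P [A′ 0; 0 u] P⁻¹`, `A′ = (tr A)•1 − A` (the conjugate root of `q` in `L_w[A]`) —
`s₁′ ∈ G_v` by (U), `s₁′ ∈ k`, `s₁′ ≠ s₁`, and every `s ∈ k` stably conjugate to `t` commutes with `s₁` with `χ_s = χ_t = χ_{s₁}`, so `s ∈ {s₁, s₁′}` by (C).  The type-(2) twin of ★ F5b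
`natCard_stableSet_eq_six` (p. 182: «the number of `ν ∈ 𝔇(T∕F)` such that `T^ν` is conjugate to `T″` is `|Ω_F(T)|∕|Ω(T″)|`», here `|Ω_F(T_K × E¹)| = 2`).
[cite: Rogawski1990, §12.5 p. 182; §3.6 p. 31; §3.5 Prop. 3.5.2 (a)(c) p. 29] -/
theorem natCard_stableSet_eq_two (hns : ∀ w : PlacesOver L v, IsCMField.complexConj L • w.1 = w.1) {K : Subgroup (Gqs L v)} {s₁ t : Gqs L v}
    (q : (LocalRing L v)[X]) (u : LocalRing L v) (hq : Irreducible q) (hq2 : q.natDegree = 2) (hs₁ : s₁.val.val.charpoly = q * (X - C u))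
    (hK : Subgroup.centralizer ({s₁} : Set (Gqs L v)) = K) (ht : t.val.val.charpoly = q * (X - C u)) :
    Nat.card {s : ↥K // IsStablyConjGAt L (R90.S4.splitFormGL L) v t (s : Gqs L v)} = 2 := by
  classical
  subst hK
  obtain ⟨w⟩ := (inferInstance : Nonempty (PlacesOver L v))
  letI : Field (LocalRing L v) := (LocalRing.isField_of_smul_eq (IsCMField.complexConj L) (IsCMField.complexConj_ne_one L) w (hns w)).toField
  haveI : CharZero (LocalRing L v) := charZero_of_injective_algebraMap (algebraMap L (LocalRing L v)).injective
  have hH : IsUnit (cmLocalForm L 3 v).det := by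
    rw [cmLocalForm_eq_over]; exact (Matrix.isUnit_iff_isUnit_det _).1 ((StdForm.antidiagonal 3).isUnit_over _)
  have hHh : ((cmLocalForm L 3 v).map (conjLocal L (IsCMField.complexConj L) v))ᵀ = cmLocalForm L 3 v := by
    rw [cmLocalForm_eq_over, StdForm.over_map, StdForm.transpose_over]
  have hσ : ∀ r : LocalRing L v, conjLocal L (IsCMField.complexConj L) v (conjLocal L (IsCMField.complexConj L) v r) = r :=
    Literature.NumberTheory.Weil1982.UnitaryFinTopForm.conjLocal_conjLocal L v
  have hs₁U : s₁.val ∈ unitaryGroup (conjLocal L (IsCMField.complexConj L) v) (cmLocalForm L 3 v) := by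
    rw [← unitaryGroupOfForm_cmLocalForm_eq_unitaryGroup]; exact s₁.2
  -- the block frame of `s₁` (★ FILE 0) and the conjugate-root element `s₂ = P [A′ 0; 0 u] P⁻¹ ∈ G_v` ((U))
  obtain ⟨P, e, A, hP, hAq, hA⟩ := exists_blockFrame_gqs_of_charpoly L v hns s₁ q u hq hq2 hs₁
  obtain ⟨h0, hU⟩ := conj_blockFrame_trace_smul_sub_mem_unitaryGroup hσ hHh hH hs₁U hP hA
  have hU' : Matrix.GeneralLinearGroup.mkOfDetNeZero _ h0 ∈ unitaryGroupOfForm (conjLocal L (IsCMField.complexConj L) v) (cmLocalForm L 3 v) := by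
    rw [unitaryGroupOfForm_cmLocalForm_eq_unitaryGroup]; exact hU
  set s₂ : Gqs L v := ⟨_, hU'⟩ with hs₂def
  have hs₂val : s₂.val.val = P.val * reindex e e (fromBlocks (A.trace • (1 : Matrix (Fin 2) (Fin 2) (LocalRing L v)) - A) 0 0 !![u]) * (P⁻¹).val := rfl
  have hs₂Z : s₂ ∈ Subgroup.centralizer ({s₁} : Set (Gqs L v)) := by
    refine Subgroup.mem_centralizer_singleton_iff.2 (Subtype.ext (Units.ext ?_))
    show s₂.val.val * s₁.val.val = s₁.val.val * s₂.val.val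
    rw [hs₂val]
    exact (commute_conj_blockFrame e hP (((Commute.one_left A).smul_left A.trace).sub_left (Commute.refl A)) u).eq
  have hs₂char : s₂.val.val.charpoly = q * (X - C u) := by
    rw [hs₂val, charpoly_conj_blockFrame, charpoly_trace_smul_one_sub, hAq]
  have hs₂st : IsStablyConjGAt L (R90.S4.splitFormGL L) v t s₂ := isStablyConjGAt_of_charpoly_eq_mul hns q u hq hq2 ht hs₂char
  have hs₁Z : s₁ ∈ Subgroup.centralizer ({s₁} : Set (Gqs L v)) := Subgroup.mem_centralizer_singleton_iff.2 rfl
  have hs₁st : IsStablyConjGAt L (R90.S4.splitFormGL L) v t s₁ := isStablyConjGAt_of_charpoly_eq_mul hns q u hq hq2 ht hs₁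
  have hs₁val : s₁.val.val = P.val * reindex e e (fromBlocks A 0 0 !![u]) * (P⁻¹).val := eq_conj_blockFrame_of_frame hP
  -- `s₁ ≠ s₂` since `A′ ≠ A`
  have hne : s₁.val.val ≠ s₂.val.val := by
    intro h
    rw [hs₁val, hs₂val] at h
    have h' : reindex e e (fromBlocks A 0 0 !![u]) = reindex e e (fromBlocks (A.trace • (1 : Matrix (Fin 2) (Fin 2) (LocalRing L v)) - A) 0 0 !![u]) := by
      have h1 := congrArg (fun M => (P⁻¹).val * M * P.val) h
      simp only [Matrix.mul_assoc, ← Units.val_mul, inv_mul_cancel, Units.val_one, Matrix.mul_one] at h1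
      rwa [← Matrix.mul_assoc, ← Matrix.mul_assoc, ← Units.val_mul, inv_mul_cancel, Units.val_one, Matrix.one_mul, Matrix.one_mul] at h1
    exact trace_smul_one_sub_ne hA ((blockFrame_inj e).1 h').1.symm
  -- the two-element set
  rw [Nat.card_eq_two_iff]
  refine ⟨⟨⟨s₁, hs₁Z⟩, hs₁st⟩, ⟨⟨s₂, hs₂Z⟩, hs₂st⟩, fun h => hne (congrArg (fun s => ((s.1 : Gqs L v)).val.val) h), ?_⟩
  refine Set.eq_univ_iff_forall.2 fun s => ?_
  -- every `s ∈ Z(s₁)` stably conjugate to `t` commutes with `s₁` and has `χ_s = χ_{s₁}`: (C)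
  have hsc : Commute ((s.1 : Gqs L v)).val.val s₁.val.val :=
    congrArg (fun g : Gqs L v => g.val.val) (Subgroup.mem_centralizer_singleton_iff.1 s.1.2)
  have hschar : ((s.1 : Gqs L v)).val.val.charpoly = s₁.val.val.charpoly := by
    rw [charpoly_eq_of_isStablyConjGAt s.2, ht, hs₁]
  rcases eq_or_eq_conj_blockFrame_of_commute_of_charpoly_eq hP hA hsc hschar with h1 | h1
  · exact Or.inl (Subtype.ext (Subtype.ext (Subtype.ext (Units.ext h1))))
  · rw [← hs₂val] at h1
    exact Or.inr (Subtype.ext (Subtype.ext (Subtype.ext (Units.ext h1))))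

end GqsLevel


end Summit.HodgeConjecture.HodgeConjecture.R90.S4

end
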